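import Summits.CriticalPhenomena.CardyFormulaZ2.Theorems.BoundaryDefectGaussianR.Negative.MarkDensityPartition

/-!
# Negative lemmas for the crux `CardyBoundaryCoulombGas.BoundaryDefectGaussianR`, III —
# the mark density is sub-additive in the arc (an exact lattice constraint on member (i))

Sequel of `MarkDensityPartition.lean` (refuter, cdisprove seat
`refuter-cdisprove-stmt-CriticalPhenomena-14132-g2-0`, cycle 2; everything proved, no `sorry`, no
proposition defined, no named fact). For the member-(i) mark events `E_x(A)` of the crux
`BoundaryDefectGaussianR` (stmt-CriticalPhenomena-14132) on `ℤ × ℕ`: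

* `markEvent_union_subset` — `E_x(A ∪ A') ⊆ E_x(A) ∪ E_x(A')` (the excluded crossing event is monotone
  in the arc although the mark event is not); `markEvent_mono_excluded`;
* `markDensitySeq_arc_union_le` — at every mesh `m_δ(a,b';c,x) ≤ m_δ(a,b;c,x) + m_δ(b,b';c,x)`
  (`a ≤ b ≤ b'`);
* `limitDensity_subadditive_in_arc` — hence EVERY pointwise limit density `G` of member (i) satisfies
  `G(a,b',c,x) ≤ G(a,b,c,x) + G(b,b',c,x)`, a rigorous constraint with no percolation input. The crux's
  claimed shape `Δ^{1/3}((x-a)(x-b)(x-c))^{-2/3}` passes it (numerically the ratio right/left has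
  minimum 1.0157 over 2·10⁵ random configurations; work file `Cruxes/BoundaryDefectGaussianR/Disproof.lean`
  §9b), as it must if it is also the triangular-lattice limit — recorded as a filter for any competing
  candidate shape.
-/

noncomputable section

open Filter Topology Set MeasureTheory
open scoped BigOperators ENNReal

namespace Summit.CriticalPhenomena.CardyFormulaZ2.Theorems.BoundaryDefectGaussianR.Negative

open Literature.Probability.Percolation Literature.Probability.LatticeModels

/-- Open crossings are monotone in the source set. [folklore] -/
theorem openCrossing_mono_left {V : Type*} (S : Set V) {A A' : Set V} (h : A ⊆ A') (B : Set V) :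
    openCrossing S A B ⊆ openCrossing S A' B := by
  rintro ω ⟨x, hx, y, hy, hω⟩
  exact ⟨x, h hx, y, hy, hω⟩

/-- Union bound in the arc: `E_x(A ∪ A') ⊆ E_x(A) ∪ E_x(A')` for the mark events (the excluded
crossing event only grows with the arc). [folklore] -/
theorem markEvent_union_subset (A A' : Set (Site 2)) (j₀ j : ℤ) :
    markEvent (A ∪ A') j₀ j ⊆ markEvent A j₀ j ∪ markEvent A' j₀ j := by
  rintro ω ⟨⟨x, hx, y, hy, hω⟩, hno⟩
  rcases hx with hx | hx
  · exact Or.inl ⟨⟨x, hx, y, hy, hω⟩, fun ⟨x', hx', y', hy', hω'⟩ => hno ⟨x', Or.inl hx', y', hy', hω'⟩⟩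
  · exact Or.inr ⟨⟨x, hx, y, hy, hω⟩, fun ⟨x', hx', y', hy', hω'⟩ => hno ⟨x', Or.inr hx', y', hy', hω'⟩⟩

/-- The mark event is anti-monotone in the arc through its excluded part: shrinking the arc can only
remove excluded crossings. Precisely `E_x(A') ∩ {x ↔ A} ⊆ E_x(A)` for `A ⊆ A'`. [folklore] -/
theorem markEvent_mono_excluded {A A' : Set (Site 2)} (h : A ⊆ A') (j₀ j : ℤ) :
    markEvent A' j₀ j ∩ openCrossing halfLattice A {![j, 0]} ⊆ markEvent A j₀ j := by
  rintro ω ⟨⟨-, hno⟩, hyes⟩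
  exact ⟨hyes, fun h' => hno (openCrossing_mono_left _ h _ h')⟩

/-- **Exact lattice constraint (every mesh): sub-additivity of the mark density in the arc**,
`m_δ(a,b';c,x) ≤ m_δ(a,b;c,x) + m_δ(b,b';c,x)` — from `[⌊an⌋,⌊b'n⌋] = [⌊an⌋,⌊bn⌋] ∪ [⌊bn⌋,⌊b'n⌋]`
(for `a ≤ b ≤ b'`) and the two lemmas above. The mark event is NOT monotone in the arc, but the
union bound survives. [folklore] -/
theorem markDensitySeq_arc_union_le {a b b' : ℝ} (hab : a ≤ b) (hbb' : b ≤ b') (c x : ℝ) (n : ℕ) :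
    markDensitySeq a b' c x n ≤ markDensitySeq a b c x n + markDensitySeq b b' c x n := by
  simp only [markDensitySeq_eq, ← mul_add]
  refine mul_le_mul_of_nonneg_left ?_ (by positivity)
  have hn : (0 : ℝ) ≤ n := by positivity
  have heq : barc a b' n = barc a b n ∪ barc b b' n := by
    ext v
    simp only [barc, Set.mem_union, Set.mem_setOf_eq]
    constructor
    · rintro ⟨h1, h2, h3⟩
      rcases le_total (v 0) ⌊b * n⌋ with h | h
      · exact Or.inl ⟨h1, h2, h⟩
      · exact Or.inr ⟨h1, h, h3⟩
    · rintro (⟨h1, h2, h3⟩ | ⟨h1, h2, h3⟩)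
      · exact ⟨h1, h2, h3.trans (Int.floor_mono (by nlinarith))⟩
      · exact ⟨h1, (Int.floor_mono (by nlinarith)).trans h2, h3⟩
  rw [heq]
  calc μhalf.real (markEvent (barc a b n ∪ barc b b' n) ⌊c * n⌋ ⌊x * n⌋)
      ≤ μhalf.real (markEvent (barc a b n) ⌊c * n⌋ ⌊x * n⌋ ∪ markEvent (barc b b' n) ⌊c * n⌋ ⌊x * n⌋) :=
        measureReal_mono (markEvent_union_subset _ _ _ _) (measure_ne_top _ _)
    _ ≤ _ := measureReal_union_le _ _

/-- Hence ANY pointwise limit density `G` of member (i) is sub-additive in the arc: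
`G(a,b',c,x) ≤ G(a,b,c,x) + G(b,b',c,x)` for `a < b < b' < c < x`. A rigorous constraint with no
percolation input; the CLAIMED shape passes it (numerically: min of the ratio right/left over 2·10⁵
random configurations is 1.0157 > 1; infimum 1 approached only degenerately),
as it must if it is also the triangular-lattice limit. [folklore] -/
theorem limitDensity_subadditive_in_arc {G : ℝ → ℝ → ℝ → ℝ → ℝ}
    (h : ∀ a b c x : ℝ, a < b → b < c → c < x → Tendsto (markDensitySeq a b c x) atTop (𝓝 (G a b c x)))
    {a b b' c x : ℝ} (hab : a < b) (hbb' : b < b') (hb'c : b' < c) (hcx : c < x) :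
    G a b' c x ≤ G a b c x + G b b' c x :=
  le_of_tendsto_of_tendsto (h a b' c x (hab.trans hbb') hb'c hcx)
    ((h a b c x hab (hbb'.trans hb'c) hcx).add (h b b' c x hbb' hb'c hcx))
    (Eventually.of_forall fun n => markDensitySeq_arc_union_le hab.le hbb'.le c x n)

end Summit.CriticalPhenomena.CardyFormulaZ2.Theorems.BoundaryDefectGaussianR.Negative
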